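import Mathlib
import HarnessLib
import Summits.ResolutionOfSingularities.ResolutionOfSingularities.Theorems.WildQuotientsWildQuotientResolutionJordanThreeTwoChartARingSide
import Summits.ResolutionOfSingularities.ResolutionOfSingularities.Theorems.WildQuotientsWildQuotientResolutionJordanFourBrickH1W
import Summits.ResolutionOfSingularities.ResolutionOfSingularities.Theorems.WildQuotientsWildQuotientResolutionBlowupExitVertexPresentation

/-!
# N4a: the cone brick `HPa` of the `J₃ ⊕ J₂` toric exit (the `μ₂`-vertex piece `V[x_a]/G ≅ ½(1,1,1) × 𝔸ⁿ⁻³`)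
(crux stmt-ResolutionOfSingularities-15640 `WildQuotients.WildQuotientResolution`, line `Sketch`;
chain w45c post-V5 width target N4a `JordanThreeTwo.jordanThreeTwo_hasResolution`
(res-L1-w45c-plan-1 NO OBJECTION 2026-08-27T14:24:34Z / 15:17:58Z, CHAIN v9 §4); the brick `HPa` of
res-L1-w45c-stub-2's scaffold `JordanThreeTwo.jordanThreeTwo_hasResolution_of_bricks` (p546956) —
VERBATIM its binder type. [OURS · L1 W4.5c] — assembly of landed decls; NOT a statement of any
manuscript; replaces the role of no printed item. Def-free.)

`JordanThreeTwo.jordanThreeTwo_coneBrick`: for `V = Bl_I 𝔸ⁿ`, `I = (x_a, x_b², x_bx_d, x_d²)`, with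
the lifted action of `⟨σ⟩` (`hJ` abstract), the stable affine open `O_a = V[x_a]` and the vertex locus
`T_a = π⁻¹V(x_a, x_b, x_d) ∖ ⋃_{j ≠ 0} V[g_j]`, EVERY blow-up of the quotient piece `O_a/G` along the
ideal sheaf of the (closed) image of `T_a` is regular. Assembly (the V4U `H₁`/`brickH1W` mould,
p519150): `BlowupExit.exists_isBlowup_regular_of_vertexPresentation` (p505172: `u := ι₀ x_a`,
`κ := {j // j ≠ 0}`, `y j := ι₀ g_j`, `F₀ := {x_a, x_b, x_d}`) reduces `HPa` to a RING BRICK over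
`Γ(O_a)`, which is res-D-pv-033's seam `JordanThreeTwo.exists_sectionsEquiv_chart_a_appLE` (p546684)
transported (`JordanFour.ringBrick_transport`) from res-L1-w45c-stub-2's ring side
`JordanThreeTwo.exists_ringBrick_chartA` (…ChartARingSide: X0 model p541527 ∘ (A1) p547722 ∘ (B),
`R₀ = k[Y] ⧸ ker (Half111.presentation)`, `J₀ = ⟨Half111.gens⟩`, `Half111.blowup_regular` p500272);
the ∀-form by uniqueness of blowing up (`IsBlowup.unique`).
-/

-- single-problem summit: the doubled namespace component `ResolutionOfSingularities` is forced
set_option linter.dupNamespace false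

noncomputable section

open CategoryTheory AlgebraicGeometry TopologicalSpace MvPolynomial
open Literature.AlgebraicGeometry.Resolution Literature.AlgebraicGeometry.RelativeSpec

namespace Summit.ResolutionOfSingularities.ResolutionOfSingularities.Theorems.WildQuotientResolution.JordanThreeTwo

section ConeBrick

variable (k : Type) [Field k] (n : ℕ) (a b d : Fin n)

/-- The generator vector of record (local shorthand). -/
local notation3 "g4" => (![X a, X b ^ 2, X b * X d, X d ^ 2] : Fin 4 → MvPolynomial (Fin n) k)
/-- The centre `I = (x_a, x_b², x_bx_d, x_d²)` (local shorthand). -/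
local notation3 "I4" => Ideal.span (Set.range g4)
/-- `k[x] → Γ(Spec k[x], ⊤)` (local shorthand). -/
local notation3 "ι₀" => (Scheme.ΓSpecIso (CommRingCat.of (MvPolynomial (Fin n) k))).inv.hom
/-- The cone chart `V[x_a]` of `V = Bl_I 𝔸ⁿ` (local shorthand). -/
local notation3 "VchA" => blowupChart (affineBlowup.π I4) (affineBlowup.idealSheaf I4)
  ⟨⊤, isAffineOpen_top _⟩ (ι₀ (X a))
/-- The vertex locus `T_a = π⁻¹V(x_a, x_b, x_d) ∖ ⋃_{j ≠ 0} V[gens j]` (local shorthand). -/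
local notation3 "Ta" => ({v : ↥(affineBlowup I4) | (affineBlowup.π I4).base v ∈
      PrimeSpectrum.zeroLocus ({X a, X b, X d} : Set (MvPolynomial (Fin n) k))} \
    ((⨆ j : {j : Fin 4 // j ≠ 0}, blowupChart (affineBlowup.π I4) (affineBlowup.idealSheaf I4)
      ⟨⊤, isAffineOpen_top _⟩ (ι₀ (g4 j.1)) : (affineBlowup I4).Opens) : Set ↥(affineBlowup I4)))
/-- The quotient map `𝔸ⁿ → 𝔸ⁿ/⟨σ⟩` (local shorthand). -/
local notation3 "qσ" σ' => Spec.map (CommRingCat.ofHom (algebraMap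
  (FixedPoints.subalgebra k (MvPolynomial (Fin n) k) (Subgroup.zpowers σ')) (MvPolynomial (Fin n) k)))

/-- `V[x_a] ≤ π⁻¹ ⊤` (local shorthand). -/
local notation3 "hVchA" => blowupChart_le_preimage (affineBlowup.π I4) (affineBlowup.idealSheaf I4)
  ⟨⊤, isAffineOpen_top _⟩ (ι₀ (X a))

-- the statement is long (literal binder type of the generic `H`); elaboration needs head-room
set_option maxHeartbeats 1600000 in
/-- **The RING BRICK over `Γ(O_a)`** (the hypothesis `H` of
`BlowupExit.exists_isBlowup_regular_of_vertexPresentation` at `u := ι₀ x_a`, `κ := {j // j ≠ 0}`,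
`y j := ι₀ g_j`, `F₀ := {x_a, x_b, x_d}`, `O := O_a`, literally): res-D-pv-033's seam (p546684) ∘
`JordanFour.ringBrick_transport` ∘ `JordanThreeTwo.exists_ringBrick_chartA` (p548513).
[OURS · L1 W4.5c] [folklore; assembly of landed decls] -/
theorem jordanThreeTwo_ringBrickA (p : ℕ) (hp : p.Prime) (hp3 : 3 ≤ p) [CharP k p]
    (σ : MvPolynomial (Fin n) k ≃ₐ[k] MvPolynomial (Fin n) k) [Finite ↥(Subgroup.zpowers σ)]
    (c e : Fin n) (hab : a ≠ b) (hac : a ≠ c) (had : a ≠ d) (hae : a ≠ e) (hbc : b ≠ c) (hbd : b ≠ d)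
    (hbe : b ≠ e) (hcd : c ≠ d) (hce : c ≠ e) (hde : d ≠ e)
    (hb : σ (X b) = X b + X a) (hc : σ (X c) = X c + X b) (he : σ (X e) = X e + X d)
    (hσ : ∀ i, i ≠ b → i ≠ c → i ≠ e → σ (X i) = X i)
    (ρ : ↥(Subgroup.zpowers σ) →* Aut (Spec (CommRingCat.of (MvPolynomial (Fin n) k))))
    (hρ : ∀ g : ↥(Subgroup.zpowers σ), (ρ g).hom = Spec.map (CommRingCat.ofHom
      ((MulSemiringAction.toRingEquiv (↥(Subgroup.zpowers σ)) (MvPolynomial (Fin n) k) g⁻¹ :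
        MvPolynomial (Fin n) k ≃+* MvPolynomial (Fin n) k) :
          MvPolynomial (Fin n) k →+* MvPolynomial (Fin n) k)))
    (hJ : ∀ g : ↥(Subgroup.zpowers σ),
      (affineBlowup.idealSheaf I4).comap (ρ g).hom = affineBlowup.idealSheaf I4)
    (ρB : ActionOver (affineBlowup.π I4 ≫ qσ σ) ↥(Subgroup.zpowers σ))
    (haut : ρB.aut = (affineBlowup.isBlowup I4).liftAction ρ hJ)
    (Oa : ρB.StableAffineOpens) (hOa : Oa.1 = VchA)
    (hle : ((Oa.1.ι ≫ affineBlowup.π I4 ≫ qσ σ) ⁻¹ᵁ ⊤ : (Oa.1 : Scheme.{0}).Opens) ≤ Oa.1.ι ⁻¹ᵁ VchA)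
    (T : {j : Fin 4 // j ≠ 0} → Γ(affineBlowup I4, VchA))
    (hT : ∀ j, (affineBlowup.π I4).appLE ⊤ VchA hVchA (ι₀ (g4 j.1)) =
      (affineBlowup.π I4).appLE ⊤ VchA hVchA (ι₀ (X a)) * T j) :
    ∃ (R₀ : Type) (_ : CommRing R₀) (J₀ : Ideal R₀)
      (ψ : R₀ →+* Γ((Oa.1 : Scheme.{0}), (Oa.1.ι ≫ affineBlowup.π I4 ≫ qσ σ) ⁻¹ᵁ ⊤)),
      Function.Injective ψ ∧ ψ.range = (ρB.restrict Oa.1 Oa.2.1).invariantsRing ⊤ ∧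
      J₀.IsRadical ∧ Scheme.IsRegular (affineBlowup J₀) ∧
      ((Ideal.span ((Oa.1.ι.appLE VchA ((Oa.1.ι ≫ affineBlowup.π I4 ≫ qσ σ) ⁻¹ᵁ ⊤) hle) ''
        (((affineBlowup.π I4).appLE ⊤ VchA hVchA) ''
          ((Scheme.ΓSpecIso (CommRingCat.of (MvPolynomial (Fin n) k))).inv ''
            ({X a, X b, X d} : Set (MvPolynomial (Fin n) k))) ∪
          Set.range T))).comap ψ).radical = J₀ := by
  have Hseam := exists_sectionsEquiv_chart_a_appLE k n σ a b c d e hab hac hae hbd hcd hde hb hσ ρ hρ hJ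
    ρB haut Oa hOa hle
  rcases Hseam with ⟨φ, hP, Ω, hφ, hΩi, -, hΩiii⟩
  exact JordanFour.ringBrick_transport _ _ _ _ Ω hΩi _ _ hΩiii (X a : MvPolynomial (Fin n) k) _
    ({X a, X b, X d} : Set (MvPolynomial (Fin n) k)) T hT
    (fun t ht => exists_ringBrick_chartA k n a b c d e p hp hp3 σ hab hac had hae hbc hbd hbe hcd hce hde
      hb hc he hσ φ hφ hP t ht)

-- the statement is long (literal binder type of the scaffold); elaboration needs head-room
set_option maxHeartbeats 1600000 in
/-- **The cone brick `HPa` of the `J₃ ⊕ J₂` toric exit** (hypothesis `HPa` of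
`JordanThreeTwo.jordanThreeTwo_hasResolution_of_bricks`, p546956, literally; see the module
docstring). `p` prime, `3 ≤ p = char k`. [OURS · L1 W4.5c] [folklore; assembly of landed decls] -/
theorem jordanThreeTwo_coneBrick (p : ℕ) (hp : p.Prime) (hp3 : 3 ≤ p) [CharP k p]
    (σ : MvPolynomial (Fin n) k ≃ₐ[k] MvPolynomial (Fin n) k) [Finite ↥(Subgroup.zpowers σ)]
    (c e : Fin n) (hab : a ≠ b) (hac : a ≠ c) (had : a ≠ d) (hae : a ≠ e) (hbc : b ≠ c) (hbd : b ≠ d)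
    (hbe : b ≠ e) (hcd : c ≠ d) (hce : c ≠ e) (hde : d ≠ e)
    (hb : σ (X b) = X b + X a) (hc : σ (X c) = X c + X b) (he : σ (X e) = X e + X d)
    (hσ : ∀ i, i ≠ b → i ≠ c → i ≠ e → σ (X i) = X i) :
    ∀ (ρ : ↥(Subgroup.zpowers σ) →* Aut (Spec (CommRingCat.of (MvPolynomial (Fin n) k))))
      (_ : (∀ g : ↥(Subgroup.zpowers σ), (ρ g).hom = Spec.map (CommRingCat.ofHom
        ((MulSemiringAction.toRingEquiv (↥(Subgroup.zpowers σ)) (MvPolynomial (Fin n) k) g⁻¹ :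
          MvPolynomial (Fin n) k ≃+* MvPolynomial (Fin n) k) :
            MvPolynomial (Fin n) k →+* MvPolynomial (Fin n) k))))
      (hJ : (∀ g : ↥(Subgroup.zpowers σ),
        (affineBlowup.idealSheaf I4).comap (ρ g).hom = affineBlowup.idealSheaf I4))
      (ρB : ActionOver (affineBlowup.π I4 ≫ qσ σ) ↥(Subgroup.zpowers σ))
      (_ : ρB.aut = (affineBlowup.isBlowup I4).liftAction ρ hJ)
      (Oa : ρB.StableAffineOpens) (_ : Oa.1 = VchA)
      (Za : Closeds (ρB.pieceQuot Oa)),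
      (Za : Set (ρB.pieceQuot Oa)) = (ρB.pieceMk Oa).base '' (Oa.1.ι.base ⁻¹' Ta) →
      ∀ (B' : Scheme.{0}) (pB : B' ⟶ ρB.pieceQuot Oa),
        IsBlowup pB (Scheme.IdealSheafData.vanishingIdeal Za) → Scheme.IsRegular B' := by
  classical
  have hπ : IsBlowup (affineBlowup.π I4) (affineBlowup.idealSheaf I4) := affineBlowup.isBlowup I4
  have hxa : ι₀ (X a) ∈ (affineBlowup.idealSheaf I4).ideal ⟨⊤, isAffineOpen_top _⟩ :=
    ι_gens_mem_ideal_top k n a b d 0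
  haveI : IsAffine (Spec (CommRingCat.of
    (FixedPoints.subalgebra k (MvPolynomial (Fin n) k) (Subgroup.zpowers σ)))) := inferInstance
  intro ρ hρ hJ ρB haut Oa hOa Za hZa B' pB hpB
  have hO : Oa.1 ≤ VchA := le_of_eq hOa
  have hle : ((Oa.1.ι ≫ affineBlowup.π I4 ≫ qσ σ) ⁻¹ᵁ ⊤ : (Oa.1 : Scheme.{0}).Opens) ≤
      Oa.1.ι ⁻¹ᵁ VchA := by
    intro x _
    rw [Scheme.Hom.mem_preimage]
    apply hO
    have hx : Oa.1.ι.base x ∈ Set.range Oa.1.ι.base := ⟨x, rfl⟩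
    rw [Scheme.Opens.range_ι] at hx
    exact hx
  -- the ∃-form from the ring brick over `Γ(O_a)`
  obtain ⟨B, pB₀, hpB₀, hreg⟩ := BlowupExit.exists_isBlowup_regular_of_vertexPresentation hπ _ ρB
    hxa (fun j : {j : Fin 4 // j ≠ 0} => ι₀ (g4 j.1)) (fun j => ι_gens_mem_ideal_top k n a b d j.1)
    ({X a, X b, X d} : Set (MvPolynomial (Fin n) k)) Oa hO hle
    (jordanThreeTwo_ringBrickA k n a b d p hp hp3 σ c e hab hac had hae hbc hbd hbe hcd hce hde hb hc he hσ
      ρ hρ hJ ρB haut Oa hOa hle)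
    Za hZa
  -- uniqueness of blowing ups
  obtain ⟨e', -, -⟩ := hpB₀.unique hpB
  exact Scheme.IsRegular.of_iso e'.hom hreg

end ConeBrick

end Summit.ResolutionOfSingularities.ResolutionOfSingularities.Theorems.WildQuotientResolution.JordanThreeTwo

end
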